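import Summits.BirchSwinnertonDyer.BirchSwinnertonDyer.Theorems.SchneiderFreeAdditiveX3AnomalousTwistAlgebraicSideOfRHPWL
import Summits.BirchSwinnertonDyer.BirchSwinnertonDyer.Theorems.EisensteinPrimesResidualPairMuLambdaOfPub
import Summits.BirchSwinnertonDyer.BirchSwinnertonDyer.Theorems.SchneiderFreeAdditiveX3KYBranchThreeOfPrint
import Summits.BirchSwinnertonDyer.BirchSwinnertonDyer.Theorems.SchneiderFreeAdditiveX3GordCellThreeAux
import Summits.BirchSwinnertonDyer.BirchSwinnertonDyer.Theorems.EisensteinPrimesXAcImprimitiveLambdaShift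
import Summits.BirchSwinnertonDyer.BirchSwinnertonDyer.Theorems.EisensteinPrimesFSideCorankLeOffP
import HarnessLib

/-!
# Route `SchneiderFreeAdditiveX3` (K1 door): Keller–Yin Thm. 3.5.1 IN BRANCH CURRENCY AT `p = 3` FOR AN ANOMALOUS TWIST — `λ(𝓛_ε) ≤ λ(𝔛)`
# from the analytic count, and `Ch_Λ(𝔛)·R₀⟦T⟧ = (𝓛_ε)` from [DIV.dvd] — with the branch main conjectures [BR𝟙]/[BRω] and the algebraic side
# served BY NAME from PUBLISHED facts ∪ {[RH], [PWL-θ]}; the only displayed analytic input is the Eisenstein-congruence COUNT at the datum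

Cell `bsd-schneider-ideate`, seat `bsd-schneider-door-c5` (prover, generation 32; assembly layer; `--supports` 19177, helper).
PARTITION: board row B6 ∩ X3 ∩ sst-twist, `r = 1`, (G-ord, `e = 2`) half at `p = 3`, the 1 725 ANOMALOUS pairs of `Rank1Residual.partition` —
the anomalous twin of generation 26's `KYBranchThree` (686 NAT pairs); types-the-object-of nothing; closes none of B6's cells (BSD NOT advanced).
bears_on: K1-door (items 18971/18972 retired → 19177 r3 `GordTwoBranchIMC`).  FILE 13 of the anomalous-twin port.

## What (the anomalous analogue of generation 26's F4 `KYBranchThree.xac_charIdeal_map_eq_span_three_of_dvd`)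

Setting: `W/ℚ` globally minimal on the (G-ord, `e = 2`) cell at `3` (`ClassX3 W 3`, `SubGordTwo W 3`), `r_an(W) = 1`, with an ANOMALOUS
good-ordinary twist model `W = C • V^{(3*)}` (`GoodOrd V 3`, `3 ∣ a₃(V) − 1`) and Keller–Yin's normalisation «every rational `3`-line of `W` is
`D₃`-non-trivial»; `K` imaginary quadratic, (Heeg) for `N_W`, `d_K` odd `≠ −3`, `cd₃ ≤ 2`, `3 = v v̄` with `v` read by `ι : K → ℚ₃` and by
`ι' : ℚ̄₃ ≅ ℂ`; `κ` anticyclotomic, `γ`; a rational `3`-line `Ψ ≤ W[3]` with Teichmüller pair `(θsub, θquot)` over `ℚ` — by §0 `θquot` is the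
`3`-UNRAMIFIED member (CGLS's `φ′`, here `φ′|_{G_v̄} = 𝟙`: the anomalous case) —, the Hecke character `θK` of `θquot|_K` with a Katz frame
`Lφ` (CGLS Thm. 2.1.2), `Sf` the `3`-free places over `N_W`.
* §0 `isUnramifiedAt_three_quotChar_of_anomalousTwist_of_normalised` — `θquot` is unramified at `3` (generation 27's inertia dichotomy for
  good-ordinary twist models + generation 31's «`θsub|_K` ramified at `v̄`» under the normalisation); `isUnramifiedAt_quotChar_of_conductorNorm_notMem`
  — and off `N_W` (Néron–Ogg–Shafarevich, `3 ∣ N_W`).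
* §1 **`le_lambdaInvariant_xAc_empty_of_anacong_count`** — [INV.λ≤] for the anomalous twin: IF a series `L` and the Katz frame `Lφ` have
  first unit coefficients at `n`, `nφ` with the Eisenstein-congruence COUNT `n + Σ_{w∈Sf} λ𝒫_w(W_K) = 2·nφ + Σ_{w∈Sf}(λ𝒫_w(θsub) + λ𝒫_w(θquot))`
  (the conclusion SHAPE of `KellerYin2024.thm351_anacong_branch_three` / `thm222_anacong_goodLattice_*` at the datum, displayed), THEN
  `n ≤ λ(X_ac^∅(W_K))`.  Proof: [BR𝟙] `λ(𝔛_{θquot}) = nφ + [θquot|_K = 𝟙]` — `X1.KellerYinMuLambdaSplit.CharMainConjOnTree 3` for EVERY local type,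
  DERIVED by cell `bsd-eis` from four PUBLISHED facts (`CharMainConjOnTreeOfPub.charMainConjOnTree_of_pub`: Bleher et al. 2020 Thm. 3.3.1,
  Greenberg 2016 Prop. 4.1.1, de Shalit II.6.4, Hida 2010 Thm. I); [BRω] `λ(𝔛_{θsub}) = nφ` — bsd-eis's `ResidualPairMuLambdaOfPub.omegaSide_of_pub_of_firstUnit`
  for the abstract pair `(φ, ψ) = (θquot, θsub)` (same four facts; (K-det) `θsubθquot = ω̃∘χ̄₃` is the tree's `entry_mul_entry_eq_teichmullerChar`,
  `θsub|_K ≠ 𝟙` from `W(K)[3] = 0`); the ALGEBRAIC SIDE `λ(𝔛_{θsub}) + λ(𝔛_{θquot}) + ΣΣ ≤ λ(X^{Sf}) + [θquot|_K = 𝟙]` (FILE 12b, ⟸ Greenberg ×5 +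
  `cd ≤ 2` + [RH] + [PWL-θ]); `λ(X^{Sf}) = λ(X^∅) + corank(Sel^{Sf}/Sel^∅)` (`XAcImprimitiveLambdaShift`, from [INV.μ] = FILE 12a) and bsd-eis's
  UNCONDITIONAL `corank ≤ Σ λ𝒫_w(W_K)` (`FSideCorankLeOffP`); `omega` — the two anomalous `+1`'s CANCEL.
* §2 **`xac_charIdeal_map_eq_span_three_anomalous_of_dvd`** — at Keller–Yin's datum `PotOrdSetting ι' W K v v̄ κ N` and a SIGNED Castella–Hsieh
  branch frame `L` of `(f′, χ_ε)` with the count of §1: `Ch_Λ(X_ac^∅(W_K))·R₀⟦T⟧ = (L)` and `n = λ(𝔛)` along any structure map `j` — [DIV.dvd]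
  `thm336_dvd_branch_OPEN` (PREPRINT), `𝔛` torsion with `μ = 0` (FILE 12a ⟸ [RH] + [PWL-θ]), §1, and generation 24's hinge
  `KYBranchHalves.charIdeal_map_eq_span_of_C_pow_mul_mem_of_firstUnitCoeff_le` (the door direction `≤` is `.1.le`).

INPUT LEDGER, (G-ord, `e = 2`) cell at `p = 3`, ANOMALOUS pairs (1 725), Keller–Yin Thm. 3.5.1 at the Keller–Yin datum: BEFORE (generation 31)
{[DIV.dvd] PRE, [AN3-anom] PRE/untyped, [BR] for the anomalous branches untyped, [RH], [PWL-θ], [INV.μ] displayed}; AFTER this file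
{[DIV.dvd] (PRE), the ANALYTIC COUNT at the datum (displayed clause — the `hna`-free shape of `thm351_anacong_branch_three`, whose composition
of refereed print at `p = 3` (FINDING-door-c5-g26 §2 steps (1)–(5)) is to be re-audited WITHOUT the non-anomalous clause: typer/audit item),
[RH], [PWL-θ] (bsd-eis typed)} ∪ FIFTEEN PUBLISHED named facts (Greenberg 2016 Props. 2.6.3, 4.1.1; Greenberg 2006 Props. 3.2, 4.1, 4.2, §5 A;
NSW (8.3.18) as `cd ≤ 2`; Bleher et al. Thm. 3.3.1; de Shalit II.6.4; Hida Thm. I) — [BR𝟙]/[BRω] for the anomalous branches are NO LONGER inputs.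

HONEST FRAMING: compositions of tree theorems CONDITIONAL on the displayed hypotheses ([DIV.dvd] carries Keller–Yin's claim tag — unrefereed
preprint, and at `p = 3` outside its printed range; the analytic count is DISPLAYED, not derived; [RH]/[PWL-θ] and the published facts are typed
`Prop`s, not proved in the tree); no definition, no named fact introduced, no `sorry`; no registered stub of 19177 closed; the crux stays OPEN; BSD
proved for no curve; «closes rung: none».
References: [KellerYin2024b] Thm. 3.3.6, Prop. 3.4.4, §3.5, Thm. 3.5.1 (arXiv:2410.23241); [KellerYin2024] Thm. 1.2.2, Prop. 1.2.5, Thm. 1.4.1,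
Thm. 2.2.2 (arXiv:2402.12781v2); [CastellaGrossiLeeSkinner2022] Thms. 1.2.2, 2.1.2, 2.2.2, (2.16); [BleherEtAl2020] Thm. 3.3.1; [deShalit1987]
II.6.4; [Hida2010MuInvariant] Thm. I; [Greenberg2016Selmer] 2.6.3, 4.1.1; [Greenberg2006] 3.2, 4.1, 4.2, §5 A; [GreenbergVatsal2000] Cor. (2.3);
[Washington1997] §7.1; this seat p722295/p723923 (F11/F12b), p680448 (gen 26), p684153 (gen 27); bsd-eis x2-p2 g17 (`…OfPub`).
-/

set_option autoImplicit false
set_option linter.dupNamespace false -- the summit namespace `…BirchSwinnertonDyer.BirchSwinnertonDyer.Theorems` (Sub = Summit, D-0017) trips it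

noncomputable section

open scoped Classical Pointwise NumberField

open WeierstrassCurve NumberField IsDedekindDomain Field PowerSeries Filter
  Literature.NumberTheory.EllipticCurves Literature.NumberTheory.EllipticCurves.IwasawaAlgebra
  Literature.NumberTheory.EllipticCurves.GreenbergSelmer
  Literature.NumberTheory.EllipticCurves.GreenbergVatsal2000
  Literature.NumberTheory.GaloisRepresentations IsDedekindDomain.HeightOneSpectrum
  Literature.NumberTheory.EllipticCurves.ModularForms
  Literature.NumberTheory.EllipticCurves.Rank1Residual Literature.NumberTheory.EllipticCurves.KellerYin2024
  Literature.NumberTheory.EllipticCurves.IwasawaDual Literature.NumberTheory.EllipticCurves.Castella2018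
  Literature.NumberTheory.EllipticCurves.Castella2018.AcSelmer
  Literature.NumberTheory.IwasawaTheory Literature.NumberTheory.IwasawaTheory.Greenberg2016
  Literature.NumberTheory.IwasawaTheory.Greenberg2006 Literature.NumberTheory.GaloisCohomology
  Literature.NumberTheory.EllipticCurves.Rubin1991 Literature.NumberTheory.EllipticCurves.DeShalit1987
  Literature.NumberTheory.EllipticCurves.Hida2010MuInvariant Literature.NumberTheory.EllipticCurves.BCGKPST2020
  Summit.BirchSwinnertonDyer.Rank1Residual Summit.BirchSwinnertonDyer.Rank1Residual.Additive
  Summit.BirchSwinnertonDyer.Rank1Residual.GaloisImage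
  Summit.BirchSwinnertonDyer.Rank1Residual.X1.KellerYinMuLambdaSplit
  Summit.BirchSwinnertonDyer.BirchSwinnertonDyer.Theorems
  Summit.BirchSwinnertonDyer.BirchSwinnertonDyer.Theorems.EisensteinPrimesMuLambda
  Summit.BirchSwinnertonDyer.BirchSwinnertonDyer.Theorems.SchneiderFree
  Summit.BirchSwinnertonDyer.BirchSwinnertonDyer.Theorems.SchneiderFreeAdditiveX3
  Summit.BirchSwinnertonDyer.BirchSwinnertonDyer.Theorems.SchneiderFreeAdditiveX3.KYBranchHalves
  Summit.BirchSwinnertonDyer.BirchSwinnertonDyer.Theorems.SchneiderFreeAdditiveX3.AnomalousTwistPartnerFacts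
  Summit.BirchSwinnertonDyer.BirchSwinnertonDyer.Theorems.SchneiderFreeAdditiveX3.AnomalousTwistAlgebraicSideOfRHPWL

namespace Summit.BirchSwinnertonDyer.BirchSwinnertonDyer.Theorems.SchneiderFreeAdditiveX3.KYBranchThreeAnomalous

open Literature.NumberTheory.EllipticCurves.KellerYin2024 (thm122_rubinHida_residualPair_unrSelmer prop125_residualPair_unrSelmer_imprimitive)
open Literature.NumberTheory.EllipticCurves.CastellaGrossiLeeSkinner2022 (IsKatzLFunction)

variable {K : Type} [Field K] [NumberField K]

/-! ### §0 The quotient character of the normalised anomalous twist is unramified at `3` and off `N_W` -/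

section Unramified

variable {V W : WeierstrassCurve ℚ} [V.IsElliptic] [V.IsGloballyMinimal] [W.IsElliptic] [W.IsGloballyMinimal]

omit [NumberField K] in
/-- `unitChar θ τ = 1` when `θ τ = 1` (plumbing). [folklore] -/
private theorem unitChar_eq_one_of_apply_eq_one {p : ℕ} [Fact p.Prime]
    (θ : FramedGaloisRep K (padicCoeffIntegers (∅ : Set (PadicAlgCl p))) 1) {τ : absoluteGaloisGroup K} (h : θ τ = 1) :
    unitChar θ τ = 1 := by
  change (Units.map (padicIntEquivCoeffIntegersEmpty p).symm.toRingHom.toMonoidHom) (Matrix.GeneralLinearGroup.det (θ τ)) = 1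
  rw [h, map_one, map_one]

omit [W.IsGloballyMinimal] in
/-- **The quotient character `θquot` of a rational `3`-line of the NORMALISED ANOMALOUS twist is UNRAMIFIED at `3`.**  `W = C • V^{(3*)}` with
`V/ℚ` globally minimal good ordinary anomalous at `3`, Keller–Yin's normalisation, `W[3]` reducible; `K` imaginary quadratic with `3 = v v̄` split;
`Ψ ≤ W[3]` rational with Teichmüller pair `(θsub, θquot)` over `ℚ`.  Generation 27's inertia dichotomy for good-ordinary twist models
(`KYBranchThreeAux.teichmullerPair_isUnramifiedAt_or_of_goodOrd_negThree_twist`: `θsub` or `θquot` is unramified at `3`) and generation 31's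
orientation theorem (`θsub|_K` is RAMIFIED at `v̄` under the normalisation, `AnomalousTwistOrientation.exists_mem_inertia_unitChar_ne_one_…`)
exclude the first alternative (`I_{v̄} = I_{𝔓₀}` for the chosen prime, `FramedGaloisRep.isUnramifiedAt_restrictField`).  So `θquot` is CGLS's `φ′`
("labeled so that `p ∤ cond(φ′)`"), here with `φ′|_{G_v̄} = 𝟙`. [cite: CastellaGrossiLeeSkinner2022, §2.2 (labelling p ∤ cond φ; arXiv:2008.02571v2 TeX L1063)]
[cite: KellerYin2024, Prop. 1.3.1, §1.4 (arXiv:2402.12781v2); arXiv:2410.23241 §3.3 (normalisation)] [cite: Serre1972, §1.11 Prop. 11] -/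
theorem isUnramifiedAt_three_quotChar_of_anomalousTwist_of_normalised (hV : GoodOrd V 3) (ha : (3 : ℤ) ∣ V.frobeniusTrace 3 - 1)
    (C : VariableChange ℚ) (hC : C • V.quadraticTwist ((-1 : ℚ) ^ ((3 : ℕ) / 2) * ((3 : ℕ) : ℚ)) = W)
    (hnorm : ∀ Φ : AddSubgroup (geomTorsion W ((3 : ℕ) : ℤ)), IsRationalLine W 3 Φ → ¬ LineDecompositionTrivialAt W 3 Φ)
    (hK : IsImaginaryQuadratic K) {v vbar : HeightOneSpectrum (𝓞 K)} (hv3 : ((3 : ℕ) : 𝓞 K) ∈ v.asIdeal)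
    (hvbar : ((3 : ℕ) : 𝓞 K) ∈ vbar.asIdeal) (hne : vbar ≠ v)
    {Ψ : AddSubgroup (geomTorsion W ((3 : ℕ) : ℤ))} (hΨ : IsRationalLine W 3 Ψ)
    {θsub θquot : FramedGaloisRep ℚ (padicCoeffIntegers (∅ : Set (PadicAlgCl 3))) 1}
    (hsub : IsTeichmullerLiftOn (∅ : Set (PadicAlgCl 3)) (Ψ.map (geomTorsion W ((3 : ℕ) : ℤ)).subtype) θsub)
    (hquot : IsTeichmullerLiftOnQuot (∅ : Set (PadicAlgCl 3)) (Ψ.map (geomTorsion W ((3 : ℕ) : ℤ)).subtype)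
      (geomTorsion W ((3 : ℕ) : ℤ)) θquot) :
    ∀ u : HeightOneSpectrum (𝓞 ℚ), ((3 : ℕ) : 𝓞 ℚ) ∈ u.asIdeal → θquot.IsUnramifiedAt u := by
  have h3 : ((-1 : ℚ) ^ ((3 : ℕ) / 2) * ((3 : ℕ) : ℚ)) = (-3 : ℚ) := by norm_num
  have hC' : C • V.quadraticTwist (-3 : ℚ) = W := by rw [← h3]; exact hC
  have hredW : Red W 3 := not_hasIrreducibleModPGaloisRep_of_isRationalLine hΨ
  rcases KYBranchThreeAux.teichmullerPair_isUnramifiedAt_or_of_goodOrd_negThree_twist hV.1 hV.2 C hC' hΨ hsub hquot with h | h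
  · -- `θsub` unramified at `3` contradicts «`θsub|_K` ramified at `v̄`»
    exfalso
    have hpair : IsResidualPairOver (W.baseChange K) 3 (θsub.restrictField K) (θquot.restrictField K) :=
      isResidualPairOver_restrictField W 3 K hΨ hsub hquot
    obtain ⟨τ, hτ, hne1⟩ := AnomalousTwistOrientation.exists_mem_inertia_unitChar_ne_one_of_anomalousTwist_of_normalised rfl hV ha C
      hC hnorm hredW hK hv3 hvbar hne hpair
    have hunder : ((3 : ℕ) : 𝓞 ℚ) ∈ (vbar.under (𝓞 ℚ)).asIdeal := by
      rw [HeightOneSpectrum.under_asIdeal, Ideal.under_def, Ideal.mem_comap, map_natCast]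
      exact hvbar
    have hunrK : (θsub.restrictField K).IsUnramifiedAt vbar :=
      FramedGaloisRep.isUnramifiedAt_restrictField θsub (w := vbar) (v := vbar.under (𝓞 ℚ)) rfl (h _ hunder)
    have h1 : θsub.restrictField K τ = 1 :=
      hunrK _ (adicCompletionPrime_mem_primesAbove K vbar) τ (by rw [inertia_adicCompletionPrime_eq_map_absInertia]; exact hτ)
    exact hne1 (unitChar_eq_one_of_apply_eq_one _ h1)
  · exact h

omit [V.IsElliptic] [V.IsGloballyMinimal] [W.IsGloballyMinimal] in
/-- **`θquot` is unramified at every place `u` with `N_W ∉ 𝔭_u`** (`W` good at `u`, and `u ∤ 3` since `3 ∣ N_W` on the cell: Néron–Ogg–Shafarevich,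
bsd-eis's `isUnramifiedAt_of_isTeichmullerLiftOnQuot`). [cite: SilvermanAEC2009, VII.7.1] [cite: KellerYin2024, §1.4 (arXiv:2402.12781v2)] -/
theorem isUnramifiedAt_quotChar_of_conductorNorm_notMem (haddv : Addv W 3)
    {Ψ : AddSubgroup (geomTorsion W ((3 : ℕ) : ℤ))} (hΨ : IsRationalLine W 3 Ψ)
    {θquot : FramedGaloisRep ℚ (padicCoeffIntegers (∅ : Set (PadicAlgCl 3))) 1}
    (hquot : IsTeichmullerLiftOnQuot (∅ : Set (PadicAlgCl 3)) (Ψ.map (geomTorsion W ((3 : ℕ) : ℤ)).subtype)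
      (geomTorsion W ((3 : ℕ) : ℤ)) θquot) :
    ∀ u : HeightOneSpectrum (𝓞 ℚ), ((W.conductorNorm ℤ : ℤ) : 𝓞 ℚ) ∉ u.asIdeal → θquot.IsUnramifiedAt u := by
  intro u hu
  have hcard : Nat.card (Ψ.map (geomTorsion W ((3 : ℕ) : ℤ)).subtype) = 3 := by
    rw [Nat.card_congr (Ψ.equivMapOfInjective (geomTorsion W ((3 : ℕ) : ℤ)).subtype
      (geomTorsion W ((3 : ℕ) : ℤ)).subtype_injective).toEquiv.symm, hΨ.1]
  have hpN : 3 ∣ W.conductorNorm ℤ := (W.dvd_conductorNorm_iff_not_hasGoodReductionAtPrime 3).mpr haddv.1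
  have hpu : ((3 : ℕ) : 𝓞 ℚ) ∉ u.asIdeal := fun h3 ↦ hu (by
    obtain ⟨m, hm⟩ := hpN
    rw [hm, Int.cast_natCast, Nat.cast_mul]
    exact u.asIdeal.mul_mem_right _ h3)
  exact isUnramifiedAt_of_isTeichmullerLiftOnQuot W ∅ hcard hquot (hasGoodReductionAt_of_conductorNorm_notMem W u hu) hpu

end Unramified

/-! ### §1 [INV.λ≤] for the anomalous twin at `p = 3` from the analytic COUNT, with [BR𝟙]/[BRω] and the algebraic side by name -/

section Count

/-- **[INV.λ≤] FOR THE ANOMALOUS TWIN AT `p = 3` FROM THE EISENSTEIN-CONGRUENCE COUNT.**  DATA: `W/ℚ` globally minimal, `ClassX3 W 3`,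
`SubGordTwo W 3`, `r_an(W) = 1`; an anomalous good-ordinary twist model `W = C • V^{(3*)}`; Keller–Yin's normalisation; `K` imaginary quadratic
with (Heeg) for `N_W`, `d_K` odd `≠ −3`, `cd₃(G_{K,Σ}) ≤ 2`; `3 = v v̄` with `v` read by `ι : K → ℚ₃` and by `ι' : ℚ̄₃ ≅ ℂ`; `κ` anticyclotomic,
`γ`; a rational `3`-line `Ψ ≤ W[3]` with Teichmüller pair `(θsub, θquot)` over `ℚ`; the Hecke character `θK` of `θquot|_K` (`IsHeckeCharOf`), a
finite set `Cbar` of ramified places of `θK`, a Katz frame `(Ω_K′ ≠ 0, Ω_p′ ∈ R₀ˣ, Lφ)` of `θK` (CGLS Thm. 2.1.2); `Sf` the `3`-free places over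
`N_W`; natural numbers `n`, `nφ` with `FirstUnitCoeffAt Lφ nφ` and THE COUNT `n + Σ_{w∈Sf} λ𝒫_w(W_K) = 2·nφ + Σ_{w∈Sf}(λ𝒫_w(θsub|_K) +
λ𝒫_w(θquot|_K))` (the conclusion shape of the typed analytic facts `thm351_anacong_branch_three` / `thm222_anacong_goodLattice_*` at the
datum, DISPLAYED).  NAMED FACTS: Greenberg ×5, [RH], [PWL-θ] (algebraic side, FILE 12b) and Bleher et al. Thm. 3.3.1, Greenberg 4.1.1, de
Shalit II.6.4, Hida Thm. I ([BR𝟙]/[BRω], bsd-eis's `…OfPub` files).  CONCLUSION: `n ≤ λ(X_ac^∅(W_K))`.  The anomalous `+1` of [BR𝟙]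
(`λ(𝔛_{θquot}) = nφ + [θquot|_K = 𝟙]`, Keller–Yin Thm. 2.2.3) CANCELS the `+1` of the algebraic side (Keller–Yin Thm. 1.4.1 (iii)).
[cite: KellerYin2024, Thm. 1.2.2, Prop. 1.2.5, Thm. 1.4.1 (iii), Thm. 2.2.2, proof of Thm. 2.2.3 (arXiv:2402.12781v2)]
[cite: KellerYin2024b, §3.5 and Thm. 3.5.1 (arXiv:2410.23241 p. 20) (the λ-comparison, preprint; hypotheses)]
[cite: CastellaGrossiLeeSkinner2022, Thms. 1.2.2, 2.1.2, 2.2.2 with (2.16)] [cite: BleherEtAl2020, §3.3 Thm. 3.3.1] [cite: deShalit1987, II.6.4]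
[cite: Hida2010MuInvariant, Thm. I] [cite: Greenberg2016Selmer, Props. 2.6.3, 4.1.1] [cite: Greenberg2006, Props. 3.2, 4.1, 4.2, §5 A]
[cite: GreenbergVatsal2000, §2 Cor. (2.3), Prop. (2.4)] [cite: NeukirchSchmidtWingberg2008, (8.3.18)] -/
theorem le_lambdaInvariant_xAc_empty_of_anacong_count
    (h263 : prop263_sur_of_crk) (h41 : prop41_globalEulerPoincareCorank)
    (h42 : prop42_localEulerPoincareCorank) (h5A : sec5A_localH2_subsingleton_of_LOC1)
    (h32 : prop32_cohomology_isCofinitelyGenerated)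
    (hRH : thm122_rubinHida_residualPair_unrSelmer) (hPWL : prop125_residualPair_unrSelmer_imprimitive)
    (h331 : thm331_rubin_exists_katzMeasure₂_pseudoIso_span_eq) (h411 : prop411_selmer_isAlmostDivisible)
    (hF : thmII64_katzMeasure₂_functionalEquation) (hO1 : thmI_mu_katzBranch_reflect_eq_zero)
    (W : WeierstrassCurve ℚ) [W.IsElliptic] [W.IsGloballyMinimal]
    (hr : W.analyticRank = 1) (hX : ClassX3 W 3) (hSG : SubGordTwo W 3)
    {V : WeierstrassCurve ℚ} [V.IsElliptic] [V.IsGloballyMinimal] (hV : GoodOrd V 3) (ha : (3 : ℤ) ∣ V.frobeniusTrace 3 - 1)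
    (C : VariableChange ℚ) (hC : C • V.quadraticTwist ((-1 : ℚ) ^ ((3 : ℕ) / 2) * ((3 : ℕ) : ℚ)) = W)
    (hnorm : ∀ Φ : AddSubgroup (geomTorsion W ((3 : ℕ) : ℤ)), IsRationalLine W 3 Φ → ¬ LineDecompositionTrivialAt W 3 Φ)
    (hK : IsImaginaryQuadratic K) (hCD2 : groupCdLE_two_galoisGroupUnramifiedOutside K)
    (hH : SatisfiesHeegnerHypothesis (W.conductorNorm ℤ) K) (hodd : Odd (NumberField.discr K)) (hd3 : NumberField.discr K ≠ -3)
    (ι : K →+* ℚ_[3]) (v vbar : HeightOneSpectrum (𝓞 K))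
    (hv : ∀ x : 𝓞 K, x ∈ v.asIdeal ↔ ‖ι (x : K)‖ < 1)
    (hvbar : ((3 : ℕ) : 𝓞 K) ∈ vbar.asIdeal) (hne : vbar ≠ v)
    (κ : ZpExtension K 3) (hκ : κ.IsAnticyclotomic)
    (γ : absoluteGaloisGroup K) [hγ : Fact (κ.IsTopGenerator γ)]
    {ι' : PadicAlgCl 3 ≃+* ℂ} (hι'v : ∀ (w : InfinitePlace K) (k : 𝓞 K), k ∈ v.asIdeal ↔ ‖ι'.symm (w.embedding (k : K))‖ < 1)
    {Ψ : AddSubgroup (geomTorsion W ((3 : ℕ) : ℤ))} (hΨ : IsRationalLine W 3 Ψ)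
    {θsub θquot : FramedGaloisRep ℚ (padicCoeffIntegers (∅ : Set (PadicAlgCl 3))) 1}
    (hsub : IsTeichmullerLiftOn (∅ : Set (PadicAlgCl 3)) (Ψ.map (geomTorsion W ((3 : ℕ) : ℤ)).subtype) θsub)
    (hquot : IsTeichmullerLiftOnQuot (∅ : Set (PadicAlgCl 3)) (Ψ.map (geomTorsion W ((3 : ℕ) : ℤ)).subtype)
      (geomTorsion W ((3 : ℕ) : ℤ)) θquot)
    {θK : HeckeCharacter K} (hθK : IsHeckeCharOf ι' (θquot.restrictField K) θK)
    {Cbar : Finset (HeightOneSpectrum (𝓞 K))} (hCbar : ∀ u ∈ Cbar, ¬ θK.IsUnramifiedAt u)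
    {ΩK' : ℂ} {Ωp' : (unrIntegers 3)ˣ} {Lφ : UnrSeries 3} (hΩK' : ΩK' ≠ 0)
    (hLφ : IsKatzLFunction ι' v vbar Cbar κ γ θK ΩK' ((Ωp' : unrIntegers 3) : ℂ_[3]) Lφ)
    (Sf : Finset (HeightOneSpectrum (𝓞 K)))
    (hSf : ∀ w : HeightOneSpectrum (𝓞 K), w ∈ Sf ↔
      (((W.conductorNorm ℤ : ℤ) : 𝓞 K) ∈ w.asIdeal ∧ ((3 : ℕ) : 𝓞 K) ∉ w.asIdeal))
    {n nφ : ℕ} (hLφn : FirstUnitCoeffAt Lφ nφ)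
    (hcount : n + ∑ w ∈ Sf, curveLocalLambda κ (W.baseChange K) w =
      2 * nφ + ∑ w ∈ Sf, (charLocalLambda (∅ : Set (PadicAlgCl 3)) κ (θsub.restrictField K) w +
        charLocalLambda (∅ : Set (PadicAlgCl 3)) κ (θquot.restrictField K) w)) :
    n ≤ lambdaInvariant 3 (XAc (W.baseChange K) 3 κ vbar (∅ : Set (HeightOneSpectrum (𝓞 K))) γ) := by
  haveI hEK : (W.baseChange K).IsElliptic := inferInstanceAs (W.map (algebraMap ℚ K)).IsElliptic
  have h3 : ((-1 : ℚ) ^ ((3 : ℕ) / 2) * ((3 : ℕ) : ℚ)) = (-3 : ℚ) := by norm_num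
  have hC' : C • V.quadraticTwist (-3 : ℚ) = W := by rw [← h3]; exact hC
  have hp2 : (2 : ℕ) < 3 := by norm_num
  have hv3 : ((3 : ℕ) : 𝓞 K) ∈ v.asIdeal := IndexPlumbingNrVsStrict.natCast_mem_asIdeal_of_forall_norm_iff hv
  have haddv : Addv W 3 := hX.2
  have hpN : 3 ∣ W.conductorNorm ℤ := (W.dvd_conductorNorm_iff_not_hasGoodReductionAtPrime 3).mpr haddv.1
  have hsplit : ((Ideal.span {(3 : ℤ)}).primesOver (𝓞 K)).ncard = 2 := by exact_mod_cast hH 3 Nat.prime_three hpN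
  have hH3 : SatisfiesHeegnerHypothesis 3 K := fun q hq hq3 ↦ by
    rw [(Nat.prime_dvd_prime_iff_eq hq Nat.prime_three).mp hq3]; exact_mod_cast hsplit
  have hN0 : W.conductorNorm ℤ ≠ 0 := (W.conductorNorm_pos_holds).ne'
  -- the line over `W(ℚ̄)`, its cardinality
  have hcardΨ : Nat.card (Ψ.map (geomTorsion W ((3 : ℕ) : ℤ)).subtype) = 3 := by
    rw [Nat.card_congr (Ψ.equivMapOfInjective (geomTorsion W ((3 : ℕ) : ℤ)).subtype
      (geomTorsion W ((3 : ℕ) : ℤ)).subtype_injective).toEquiv.symm, hΨ.1]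
  have hleΨ : Ψ.map (geomTorsion W ((3 : ℕ) : ℤ)).subtype ≤ geomTorsion W ((3 : ℕ) : ℤ) := AddSubgroup.map_subtype_le Ψ
  -- ramification of the pair: `θquot` unramified at `3` and off `N_W`, `θsub` unramified almost everywhere
  have hθp : ∀ u : HeightOneSpectrum (𝓞 ℚ), ((3 : ℕ) : 𝓞 ℚ) ∈ u.asIdeal → θquot.IsUnramifiedAt u :=
    isUnramifiedAt_three_quotChar_of_anomalousTwist_of_normalised hV ha C hC hnorm hK hv3 hvbar hne hΨ hsub hquot
  have hθC : ∀ u : HeightOneSpectrum (𝓞 ℚ), ((W.conductorNorm ℤ : ℤ) : 𝓞 ℚ) ∉ u.asIdeal → θquot.IsUnramifiedAt u :=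
    isUnramifiedAt_quotChar_of_conductorNorm_notMem haddv hΨ hquot
  have hNp0 : W.conductorNorm ℤ * 3 ≠ 0 := Nat.mul_ne_zero hN0 (by norm_num)
  have hψev : ∀ᶠ u : HeightOneSpectrum (𝓞 ℚ) in cofinite, θsub.IsUnramifiedAt u :=
    eventually_isUnramifiedAt_of_forall_not_mem θsub hNp0
      (isUnramifiedAt_subChar_of_conductorNorm_mul_notMem W ∅ hcardΨ hleΨ hsub)
  -- (K-det) and `θsub|_K ≠ 𝟙` (`W(K)[3] = 0` under the normalisation)
  haveI : NeZero ((3 : ℕ) : ℚ) := ⟨by norm_num⟩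
  have hdet := fun τ : absoluteGaloisGroup ℚ ↦
    entry_mul_entry_eq_teichmullerChar W (∅ : Set (PadicAlgCl 3)) hcardΨ hleΨ hsub hquot τ
  have htor : ∀ Q : (W.baseChange K).toAffine.Point, 3 • Q = 0 → Q = 0 :=
    AnomalousTwistOrientation.forall_baseChange_nsmul_eq_zero_of_anomalousTwist_of_normalised rfl hV ha C hC hnorm hX.1 hK hv3 hvbar hne
  have hnt : ∃ σ : absoluteGaloisGroup K, θsub.restrictField K σ ≠ 1 :=
    restrictField_ne_one_of_isTeichmullerLiftOn W ∅ htor hcardΨ hleΨ hsub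
  -- the BDP dual data of the two characters
  obtain ⟨Dsub⟩ := nonempty_unrDualData_char (∅ : Set (PadicAlgCl 3)) (θsub.restrictField K) κ vbar
    (∅ : Set (HeightOneSpectrum (𝓞 K))) hγ.out
  obtain ⟨Dquot⟩ := nonempty_unrDualData_char (∅ : Set (PadicAlgCl 3)) (θquot.restrictField K) κ vbar
    (∅ : Set (HeightOneSpectrum (𝓞 K))) hγ.out
  -- [BR𝟙] for `θquot` (bsd-eis, from four published facts): `λ(𝔛_{θquot}) = nφ + [θquot|_K = 𝟙]`
  obtain ⟨-, -, -, m, hLφm, hlamq⟩ := CharMainConjOnTreeOfPub.charMainConjOnTree_of_pub h331 h411 hF hO1 3 hp2 K hK hH3 hodd hd3 ι v vbar hv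
    hvbar hne κ hκ γ ι' hι'v θquot hquot.1 (W.conductorNorm ℤ) hH hθC hθp θK hθK Dquot Cbar hCbar ΩK' Ωp' Lφ hΩK' hLφ
  obtain rfl : m = nφ := hLφm.unique hLφn
  -- [BRω] for `θsub` (bsd-eis, same four facts): `λ(𝔛_{θsub}) = nφ`
  obtain ⟨-, -, -, hlams⟩ := ResidualPairMuLambdaOfPub.omegaSide_of_pub_of_firstUnit h331 h411 hF hO1 hp2 hK hH3 hodd hd3 hv hvbar hne hκ
    hι'v (φ := θquot) (ψ := θsub) hquot.1 hsub.1 hN0 hH hθC hθp hψev hdet hnt hθK hCbar hΩK' hLφ hLφn Dsub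
  -- the algebraic side (FILE 12b): `λ(𝔛_{θsub}) + λ(𝔛_{θquot}) + ΣΣ ≤ λ(X^{Sf}) + [θquot|_K = 𝟙]`
  have halg := AnomalousTwistAlgebraicSideOfRHPWL.lambdaInvariant_primitive_add_sum_le_three_of_RH_of_PWL_of_normalised_restrict h263 h41 h42
    h5A h32 hRH hPWL W hr hX hSG hV ha C hC hnorm hK hCD2 hH ι v vbar hv hvbar hne κ hκ γ hΨ hsub hquot Sf hSf Dsub Dquot
  -- `λ(X^{Sf}) = λ(X^∅) + corank(Sel^{Sf}/Sel^∅)` ([INV.μ] at `Sf`, FILE 12a) and `corank ≤ Σ λ𝒫_w(W_K)` (bsd-eis, unconditional)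
  obtain ⟨⟨hfgS, htorS, hμS⟩, -⟩ := xAc_moduleFinite_isTorsion_muInvariant_of_RH_of_PWL_of_anomalousTwist hRH hPWL C hC' hV ha hX.1 K hK hH
    hsplit ι v vbar hv hvbar hne κ hκ γ Sf hSf
  haveI := hfgS
  obtain ⟨-, -, -, -, hshift⟩ := XAcImprimitiveLambdaShift.lambdaInvariant_eq_add_zpCorank_of_muInvariant_eq_zero (W.baseChange K) 3 κ
    vbar γ (S₁ := (∅ : Set (HeightOneSpectrum (𝓞 K)))) (S₂ := (↑Sf : Set (HeightOneSpectrum (𝓞 K)))) (Set.empty_subset _) htorS hμS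
  have hcork := FSideCorankLeOffP.zpCorank_selmerAc_quotient_le_sum_curveLocalLambda_of_offP_iff W hp2 hK hH κ hκ hγ.out vbar Sf hSf
  rw [hlams, hlamq, hshift] at halg
  omega

end Count

/-! ### §2 Keller–Yin Thm. 3.5.1 in branch currency at `p = 3` for an anomalous twist: [DIV.dvd] + the count + the by-name inputs -/

section Branch

/-- **Keller–Yin Thm. 3.5.1 (branch currency) at `p = 3` for an ANOMALOUS twist, at a signed Castella–Hsieh frame, along any structure map `j`:**
`Ch_Λ(X_ac^∅(W_K))·R₀⟦T⟧ = (L)` and the first unit coefficient of `L` sits EXACTLY at `λ(𝔛)`.  DATA: Keller–Yin's datum `PotOrdSetting ι' W K v v̄ κ N`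
with `W` on the (G-ord, `e = 2`) cell, `r_an(W) = 1`, an anomalous good-ordinary twist model and the ∀-normalisation; `v` also read by
`ι : K → ℚ₃`; `cd₃ ≤ 2`; the partner newform `f′` (`3 ∤ N′`) with the twist relation; a rational `3`-line `Ψ` of `W` with pair `(θsub, θquot)`,
the Hecke character of `θquot|_K` with a Katz frame `Lφ`; a SIGNED branch frame `L` of `(f′, χ_ε)` (`e = ±1`); `Sf` the `3`-free places over
`N_W`; and THE COUNT `n + Σ λ𝒫_w(W_K) = 2·nφ + ΣΣ` at first-unit indices `n` of `L`, `nφ` of `Lφ` (displayed).  INPUTS BY NAME: [DIV.dvd]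
`thm336_dvd_branch_OPEN` (PREPRINT), [RH], [PWL-θ] (bsd-eis typed), fifteen PUBLISHED facts.  Proof: §1 (`λ(L) ≤ λ(𝔛)`), `𝔛` torsion with
`μ = 0` (FILE 12a), [DIV.dvd] at the frame, generation 24's hinge.  CONDITIONAL on the displayed statements; nothing asserted about BSD.
[claim: KellerYin2024PotOrd, status: under-review]
[cite: KellerYin2024b, Thm. 3.3.6, Prop. 3.4.4, §3.5 and Thm. 3.5.1 (arXiv:2410.23241 pp. 19–20) (preprint; hypotheses and the sentence derived)]
[cite: KellerYin2024, Thm. 1.2.2, Prop. 1.2.5, Thm. 1.4.1, Thm. 2.2.2, Thm. 2.2.3 (arXiv:2402.12781v2)]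
[cite: CastellaGrossiLeeSkinner2022, Thm. 3.2.1 ("one of the predicted divisibilities"), Thms. 1.2.2, 2.1.2, 2.2.2]
[cite: CastellaHsieh2018, §3.3, Def. 3.7 and Prop. 3.8] [cite: Washington1997, §7.1 Prop. 7.2 and §13.2] -/
theorem xac_charIdeal_map_eq_span_three_anomalous_of_dvd
    (h263 : prop263_sur_of_crk) (h41 : prop41_globalEulerPoincareCorank)
    (h42 : prop42_localEulerPoincareCorank) (h5A : sec5A_localH2_subsingleton_of_LOC1)
    (h32 : prop32_cohomology_isCofinitelyGenerated)
    (hRH : thm122_rubinHida_residualPair_unrSelmer) (hPWL : prop125_residualPair_unrSelmer_imprimitive)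
    (h331 : thm331_rubin_exists_katzMeasure₂_pseudoIso_span_eq) (h411 : prop411_selmer_isAlmostDivisible)
    (hF : thmII64_katzMeasure₂_functionalEquation) (hO1 : thmI_mu_katzBranch_reflect_eq_zero)
    (hDVD : thm336_dvd_branch_OPEN)
    (ι' : PadicAlgCl 3 ≃+* ℂ) (W : WeierstrassCurve ℚ) [W.IsElliptic] [W.IsGloballyMinimal]
    (K : Type) [Field K] [NumberField K] [IsGalois ℚ K]
    (v vbar : HeightOneSpectrum (𝓞 K)) (κ : ZpExtension K 3) (γ : absoluteGaloisGroup K)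
    [hγ : Fact (κ.IsTopGenerator γ)] {N : ℕ} [NeZero N] {f : CuspForm (CongruenceSubgroup.Gamma0 N) 2}
    (hf : IsNewformOf W f) (hS : PotOrdSetting ι' W K v vbar κ N)
    (hr : W.analyticRank = 1) (hX : ClassX3 W 3) (hSG : SubGordTwo W 3)
    {V : WeierstrassCurve ℚ} [V.IsElliptic] [V.IsGloballyMinimal] (hV : GoodOrd V 3) (ha : (3 : ℤ) ∣ V.frobeniusTrace 3 - 1)
    (C : VariableChange ℚ) (hC : C • V.quadraticTwist ((-1 : ℚ) ^ ((3 : ℕ) / 2) * ((3 : ℕ) : ℚ)) = W)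
    (hnorm : ∀ Φ : AddSubgroup (geomTorsion W ((3 : ℕ) : ℤ)), IsRationalLine W 3 Φ → ¬ LineDecompositionTrivialAt W 3 Φ)
    (hCD2 : groupCdLE_two_galoisGroupUnramifiedOutside K)
    (ι : K →+* ℚ_[3]) (hv : ∀ x : 𝓞 K, x ∈ v.asIdeal ↔ ‖ι (x : K)‖ < 1)
    {N' : ℕ} [NeZero N'] {f' : CuspForm (CongruenceSubgroup.Gamma0 N') 2} (hf' : IsNewform0 f') (hN' : ¬ 3 ∣ N')
    (htw : ∃ S : Finset ℕ, ∀ ℓ : ℕ, ℓ.Prime → ℓ ∉ S →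
      cuspCoeff f ℓ = ((legendreSym 3 ℓ : ℤ) : ℂ) * cuspCoeff f' ℓ)
    {Ψ : AddSubgroup (geomTorsion W ((3 : ℕ) : ℤ))} (hΨ : IsRationalLine W 3 Ψ)
    {θsub θquot : FramedGaloisRep ℚ (padicCoeffIntegers (∅ : Set (PadicAlgCl 3))) 1}
    (hsub : IsTeichmullerLiftOn (∅ : Set (PadicAlgCl 3)) (Ψ.map (geomTorsion W ((3 : ℕ) : ℤ)).subtype) θsub)
    (hquot : IsTeichmullerLiftOnQuot (∅ : Set (PadicAlgCl 3)) (Ψ.map (geomTorsion W ((3 : ℕ) : ℤ)).subtype)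
      (geomTorsion W ((3 : ℕ) : ℤ)) θquot)
    {θK : HeckeCharacter K} (hθK : IsHeckeCharOf ι' (θquot.restrictField K) θK)
    {Cbar : Finset (HeightOneSpectrum (𝓞 K))} (hCbar : ∀ u ∈ Cbar, ¬ θK.IsUnramifiedAt u)
    {ΩK' : ℂ} {Ωp' : (unrIntegers 3)ˣ} {Lφ : UnrSeries 3} (hΩK' : ΩK' ≠ 0)
    (hLφ : IsKatzLFunction ι' v vbar Cbar κ γ θK ΩK' ((Ωp' : unrIntegers 3) : ℂ_[3]) Lφ)
    {e : ℂ} {ΩK : ℂ} {Ωp : (unrIntegers 3)ˣ} {L : UnrSeries 3} (he : e = 1 ∨ e = -1) (hΩK : ΩK ≠ 0)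
    (hL : IsBranchBDPLFunction ι' v κ γ f' (KellerYin2024.genusHeckeCharacter K 3) e ΩK ((Ωp : unrIntegers 3) : ℂ_[3]) L)
    (Sf : Finset (HeightOneSpectrum (𝓞 K)))
    (hSf : ∀ w : HeightOneSpectrum (𝓞 K), w ∈ Sf ↔
      (((W.conductorNorm ℤ : ℤ) : 𝓞 K) ∈ w.asIdeal ∧ ((3 : ℕ) : 𝓞 K) ∉ w.asIdeal))
    {n nφ : ℕ} (hLn : FirstUnitCoeffAt L n) (hLφn : FirstUnitCoeffAt Lφ nφ)
    (hcount : n + ∑ w ∈ Sf, curveLocalLambda κ (W.baseChange K) w =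
      2 * nφ + ∑ w ∈ Sf, (charLocalLambda (∅ : Set (PadicAlgCl 3)) κ (θsub.restrictField K) w +
        charLocalLambda (∅ : Set (PadicAlgCl 3)) κ (θquot.restrictField K) w))
    (j : ℤ_[3] →+* unrIntegers 3)
    (hj : ∀ x : ℤ_[3], ((j x : unrIntegers 3) : ℂ_[3]) = algebraMap ℚ_[3] ℂ_[3] (x : ℚ_[3])) :
    (XAc.charIdeal (W.baseChange K) 3 κ vbar (∅ : Set (HeightOneSpectrum (𝓞 K))) γ).map (PowerSeries.map j) =
        Ideal.span {L} ∧
      n = lambdaInvariant 3 (XAc (W.baseChange K) 3 κ vbar (∅ : Set (HeightOneSpectrum (𝓞 K))) γ) := by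
  have h3 : ((-1 : ℚ) ^ ((3 : ℕ) / 2) * ((3 : ℕ) : ℚ)) = (-3 : ℚ) := by norm_num
  have hC' : C • V.quadraticTwist (-3 : ℚ) = W := by rw [← h3]; exact hC
  have hH : SatisfiesHeegnerHypothesis (W.conductorNorm ℤ) K := by rw [hS.level]; exact hS.heegner
  -- §1: `λ(L) ≤ λ(𝔛)`
  have hle := le_lambdaInvariant_xAc_empty_of_anacong_count h263 h41 h42 h5A h32 hRH hPWL h331 h411 hF hO1 W hr hX hSG hV ha C hC hnorm
    hS.imagQuad hCD2 hH hS.odd hS.ne_neg_three ι v vbar hv hS.mem_vbar hS.vbar_ne κ hS.anticyclotomic γ hS.induces hΨ hsub hquot hθK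
    hCbar hΩK' hLφ Sf hSf hLφn hcount
  -- `𝔛` torsion with `μ = 0` ([RH] + [PWL-θ], FILE 12a)
  have hsplit : ((Ideal.span {(3 : ℤ)}).primesOver (𝓞 K)).ncard = 2 := by exact_mod_cast hS.split
  obtain ⟨-, hT, hμ⟩ := xAc_moduleFinite_isTorsion_muInvariant_of_RH_of_PWL_of_anomalousTwist hRH hPWL C hC' hV ha hX.1 K hS.imagQuad hH
    hsplit ι v vbar hv hS.mem_vbar hS.vbar_ne κ hS.anticyclotomic γ Sf hSf
  -- [DIV.dvd] at this frame
  have he0 : e ≠ 0 := by rcases he with rfl | rfl <;> norm_num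
  have hΩp0 : ((Ωp : unrIntegers 3) : ℂ_[3]) ≠ 0 := by
    rw [Ne, ZeroMemClass.coe_eq_zero]; exact Ωp.ne_zero
  obtain ⟨k, hk⟩ := hDVD ι' W K v vbar κ γ hf hS hf' hN' htw e ΩK _ L he0 hΩK hΩp0 hL j hj
  -- the hinge (generation 24)
  haveI : Module.Finite (IwasawaAlgebra 3) (XAc (W.baseChange K) 3 κ vbar (∅ : Set (HeightOneSpectrum (𝓞 K))) γ) :=
    XAc.module_finite_empty _ 3 κ vbar γ
  obtain ⟨heq, hn⟩ := charIdeal_map_eq_span_of_C_pow_mul_mem_of_firstUnitCoeff_le _ hT hμ j hj hLn hle hk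
  exact ⟨heq, hn⟩

end Branch

end Summit.BirchSwinnertonDyer.BirchSwinnertonDyer.Theorems.SchneiderFreeAdditiveX3.KYBranchThreeAnomalous

end
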